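import Summits.Ventures.CertifiedManyBodySolver.Observables.StiffnessHalfBathtubBox
import HarnessLib

/-!
# Ventures/CertifiedManyBodySolver — Observables/StiffnessHalfBathtubSlant.lean («SLANT-CUT»: the CHORD transport of the
# half-bathtub constant between two corners at DIFFERENT densities — the trapezoid under a chord is certificate-free)

HONEST FRAMING: one-sided kinematic (one-body, half-bathtub) CEILINGS on the uniform flux stiffness, ground-state and thermal,
transported from TWO CORNERS `P₁ = (t′₁, n₁)`, `P₂ = (t′₂, n₂)` of the `(t′, n)` plane to the TRAPEZOID under their chord; pure real
analysis on explicit integrals (no definition, no named fact, no kernel evaluation, no `sorry`); a ceiling never speaks to the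
presence of order; not a `T_c` estimate, not a superconductivity verdict; the Kosterlitz–Thouless reading is CONDITIONAL on the
named dictionary. Wording class (xx1): CONTROL / CALIBRATION.

Cell `pub/hubbard-downfold` × `pub/hubbard-obs` (D-0154 (1)(C) COVERAGE, HgBa₂CuO₄₊δ «Hg-1201»), seat `hubbard-cov-hg1201-unc-2` (g3,
`prover-hubbard-cov-hg1201-unc-2-g2-0`), lane «the filling row read against the kinematic cuts». Companion of
`Observables/StiffnessHalfBathtubBox.lean` (hubbard-tc p1), whose `halfBathtub_box_le` transports two corner certificates taken at the
SAME top filling `n₂` to the rectangle `[t′₁, t′₂] × [0, n₂]`. Here the two corners sit at DIFFERENT densities and carry their OWN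
levels `νᵢ ≥ 0` and their own certified READINGS `νᵢ·nᵢ/2 + B(t′ᵢ, νᵢ) ≤ rᵢ`
(`B(t′, ν) = (4π²)⁻¹∫_{−π}^{π}∫_{−π}^{π}(cos x + cos y + 4t′cos x cos y − ν)⁺ dx dy`). Along the chord `t′(b) = (1−b)t′₁ + b t′₂`,
`n(b) = (1−b)n₁ + b n₂`, with the level `ν(b) = (1−b)ν₁ + b ν₂` (`b ∈ [0, 1]`):

* `slant_bilinear` — `ν(b)·n(b) = (1−b)·ν₁n₁ + b·ν₂n₂ + b(1−b)·(ν₁−ν₂)(n₂−n₁)` (polynomial identity);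
* joint convexity `B(t′(b), ν(b)) ≤ (1−b)·B(t′₁, ν₁) + b·B(t′₂, ν₂)` (`halfBathtubIntegral_convex`, the box file);
* hence `ν(b)·n(b)/2 + B(t′(b), ν(b)) ≤ (1−b)r₁ + b r₂ + b(1−b)·(ν₁−ν₂)(n₂−n₁)/2`, and `n ↦ ν(b)·n/2` is non-decreasing (`ν(b) ≥ 0`).

THEOREMS. `halfBathtub_slant_le` — if the SIDE CONDITION `(1−b)r₁ + b r₂ + b(1−b)(ν₁−ν₂)(n₂−n₁)/2 ≤ c` holds for every `b ∈ [0, 1]`,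
then every point of the TRAPEZOID UNDER THE CHORD, `t′ ∈ [t′₁, t′₂]` (`t′₁ < t′₂`), `n ≤ n₁ + (n₂−n₁)(t′−t′₁)/(t′₂−t′₁)`, admits a
level `ν ≥ 0` with `ν·n/2 + B(t′, ν) ≤ c`. `slant_sideCondition_of_readings` — the side condition follows from the decidable trio
`r₁ ≤ c`, `r₂ ≤ c`, `max((ν₁−ν₂)(n₂−n₁)/2, 0) ≤ |r₁ − r₂|` (the bilinear slack is absorbed by the larger-margin corner; when the levels
are ordered like the densities, `(ν₁−ν₂)(n₂−n₁) ≤ 0`, there is no slack at all). Consumers: `ObsStiffnessSeqCeilingAt_slant_of_corners_le`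
(ground-state leaf `c` on the trapezoid, every `U`), `ObsThermalStiffnessSeqCeilingAt_slant_of_corners_le` (thermal, every `β > 0`),
and the KT readings `ThermalKTDictionaryAt.le_pi_div_four_mul_slant` / `KTDictionaryAt.le_pi_div_four_mul_slant`.

USE (material-free; the Hg-1201 instances live in `Downfold/BoxesHg1201ESlantCut.lean`): a downfolded box whose corner patch has been
cut ONCE in `n` («N-KINCUT», corner `(t′₁, n₁)`) and ONCE in `t′` («TP-KINCUT», corner `(t′₂, n₂)`, `n₂` = top filling) gets the
triangle between the two cuts for free — the residual certificate domain is the triangle ABOVE the chord, HALF of the cut rectangle,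
with ZERO new kernel row (both corner rows are already in the tree). The corner inequalities are HYPOTHESES here (real-number
statements about explicit integrals, certified elsewhere by kernel-checked pair-table sums).

References: T. Hazra, N. Verma, M. Randeria, PRX 9 (2019) 031049, eqs. (2)–(6) [HazraVermaRanderia2019]; A. Paramekanti, N. Trivedi,
M. Randeria, PRB 57 (1998) 11639, eq. (3), §IV [ParamekantiTrivediRanderia1998]; W. Rudin, *Principles of Mathematical Analysis*
(1976), Thm 6.12 [Rudin1976].
-/

noncomputable section

namespace Summit.Ventures.CertifiedManyBodySolver.Observables

open Real MeasureTheory Set Filter Topology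
open Literature.MathematicalPhysics.StatisticalMechanics.KosterlitzThouless

/-! ## §1 The chord (slant) transport of the half-bathtub constant -/

/-- **The bilinear identity along a chord**: with `ν(b) = (1−b)ν₁ + bν₂`, `n(b) = (1−b)n₁ + bn₂`,
`ν(b)·n(b) = (1−b)·ν₁n₁ + b·ν₂n₂ + b(1−b)·(ν₁−ν₂)(n₂−n₁)`. [folklore] -/
theorem slant_bilinear (ν₁ ν₂ n₁ n₂ b : ℝ) :
    ((1 - b) * ν₁ + b * ν₂) * ((1 - b) * n₁ + b * n₂) =
      (1 - b) * (ν₁ * n₁) + b * (ν₂ * n₂) + b * (1 - b) * ((ν₁ - ν₂) * (n₂ - n₁)) := by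
  ring

/-- The chord parameter of `t′ ∈ [t′₁, t′₂]` (`t′₁ < t′₂`), `b = (t′ − t′₁)/(t′₂ − t′₁)`, lies in `[0, 1]` and reproduces
`t′ = (1−b)t′₁ + b t′₂`. [folklore] -/
theorem slant_param_mem {t₁ t₂ tp : ℝ} (ht : t₁ < t₂) (htp : tp ∈ Icc t₁ t₂) :
    0 ≤ (tp - t₁) / (t₂ - t₁) ∧ (tp - t₁) / (t₂ - t₁) ≤ 1 ∧
      tp = (1 - (tp - t₁) / (t₂ - t₁)) * t₁ + (tp - t₁) / (t₂ - t₁) * t₂ := by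
  have hd : 0 < t₂ - t₁ := sub_pos.2 ht
  refine ⟨div_nonneg (sub_nonneg.2 htp.1) hd.le, ?_, ?_⟩
  · rw [div_le_one hd]
    linarith [htp.2]
  · field_simp
    ring

/-- Under the chord the density is at most `2` when both corner densities are. [folklore] -/
theorem le_two_of_le_chord {n n₁ n₂ b : ℝ} (hn₁ : n₁ ≤ 2) (hn₂ : n₂ ≤ 2) (hb0 : 0 ≤ b) (hb1 : b ≤ 1)
    (hn : n ≤ n₁ + (n₂ - n₁) * b) : n ≤ 2 := by
  have h1 : (1 - b) * n₁ ≤ (1 - b) * 2 := mul_le_mul_of_nonneg_left hn₁ (by linarith)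
  have h2 : b * n₂ ≤ b * 2 := mul_le_mul_of_nonneg_left hn₂ hb0
  linarith

/-- **SLANT (CHORD) TRANSPORT of the half-bathtub constant.** Two corners `(t′₁, n₁)`, `(t′₂, n₂)` (`t′₁ < t′₂`) with levels
`ν₁, ν₂ ≥ 0` and certified readings `νᵢ·nᵢ/2 + B(t′ᵢ, νᵢ) ≤ rᵢ`; if `(1−b)r₁ + b r₂ + b(1−b)(ν₁−ν₂)(n₂−n₁)/2 ≤ c` for every
`b ∈ [0, 1]`, then for every `t′ ∈ [t′₁, t′₂]` and every `n ≤ n₁ + (n₂−n₁)(t′−t′₁)/(t′₂−t′₁)` (the trapezoid under the chord) there is a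
level `ν ≥ 0` (namely `ν(b)`) with `ν·n/2 + B(t′, ν) ≤ c`: (i) monotonicity of `n ↦ ν·n/2` up to the chord density, (ii) the bilinear
identity `slant_bilinear`, (iii) joint convexity `halfBathtubIntegral_convex`. [cite: HazraVermaRanderia2019, eqs. (2)–(6)] -/
theorem halfBathtub_slant_le {t₁ t₂ ν₁ ν₂ n₁ n₂ r₁ r₂ c : ℝ} (ht : t₁ < t₂) (hν₁ : 0 ≤ ν₁) (hν₂ : 0 ≤ ν₂)
    (h₁ : ν₁ * n₁ / 2 +
      (∫ y in (-π)..π, ∫ x in (-π)..π, max (Real.cos x + Real.cos y + 4 * t₁ * (Real.cos x * Real.cos y) - ν₁) 0) /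
        (4 * π ^ 2) ≤ r₁)
    (h₂ : ν₂ * n₂ / 2 +
      (∫ y in (-π)..π, ∫ x in (-π)..π, max (Real.cos x + Real.cos y + 4 * t₂ * (Real.cos x * Real.cos y) - ν₂) 0) /
        (4 * π ^ 2) ≤ r₂)
    (hc : ∀ b : ℝ, 0 ≤ b → b ≤ 1 → (1 - b) * r₁ + b * r₂ + b * (1 - b) * ((ν₁ - ν₂) * (n₂ - n₁) / 2) ≤ c)
    {tp n : ℝ} (htp : tp ∈ Icc t₁ t₂) (hn : n ≤ n₁ + (n₂ - n₁) * ((tp - t₁) / (t₂ - t₁))) :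
    ∃ ν : ℝ, 0 ≤ ν ∧ ν * n / 2 +
      (∫ y in (-π)..π, ∫ x in (-π)..π, max (Real.cos x + Real.cos y + 4 * tp * (Real.cos x * Real.cos y) - ν) 0) /
        (4 * π ^ 2) ≤ c := by
  have hπ2 : (0 : ℝ) < 4 * π ^ 2 := by positivity
  obtain ⟨hb0, hb1, htpab⟩ := slant_param_mem ht htp
  set b := (tp - t₁) / (t₂ - t₁) with hbdef
  have ha0 : 0 ≤ 1 - b := sub_nonneg.2 hb1
  have hab : (1 - b) + b = 1 := by ring
  have hν : 0 ≤ (1 - b) * ν₁ + b * ν₂ := add_nonneg (mul_nonneg ha0 hν₁) (mul_nonneg hb0 hν₂)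
  refine ⟨(1 - b) * ν₁ + b * ν₂, hν, ?_⟩
  -- (i) monotonicity in `n` up to the chord density `n(b) = (1 - b) n₁ + b n₂`
  have hn' : n ≤ (1 - b) * n₁ + b * n₂ := by linarith
  have hmono : ((1 - b) * ν₁ + b * ν₂) * n / 2 ≤ ((1 - b) * ν₁ + b * ν₂) * ((1 - b) * n₁ + b * n₂) / 2 := by
    have := mul_le_mul_of_nonneg_left hn' hν
    linarith
  -- (ii) the bilinear identity
  have hbil := slant_bilinear ν₁ ν₂ n₁ n₂ b
  -- (iii) joint convexity of `B` in `(t′, ν)`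
  have hconv := halfBathtubIntegral_convex t₁ t₂ ν₁ ν₂ (1 - b) b ha0 hb0 hab
  rw [← htpab] at hconv
  have hdiv := div_le_div_of_nonneg_right hconv hπ2.le
  rw [add_div, mul_div_assoc, mul_div_assoc] at hdiv
  -- the two corner readings, weighted
  have hA := mul_le_mul_of_nonneg_left h₁ ha0
  have hB := mul_le_mul_of_nonneg_left h₂ hb0
  have hcb := hc b hb0 hb1
  -- combine: ν(b)·n/2 + B(t′, ν(b)) ≤ ν(b)·n(b)/2 + (1-b)·B₁ + b·B₂ = (1-b)(ν₁n₁/2 + B₁) + b(ν₂n₂/2 + B₂) + b(1-b)(ν₁-ν₂)(n₂-n₁)/2 ≤ c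
  have e : ((1 - b) * ν₁ + b * ν₂) * ((1 - b) * n₁ + b * n₂) / 2 +
      ((1 - b) * ((∫ y in (-π)..π, ∫ x in (-π)..π,
          max (Real.cos x + Real.cos y + 4 * t₁ * (Real.cos x * Real.cos y) - ν₁) 0) / (4 * π ^ 2)) +
        b * ((∫ y in (-π)..π, ∫ x in (-π)..π,
          max (Real.cos x + Real.cos y + 4 * t₂ * (Real.cos x * Real.cos y) - ν₂) 0) / (4 * π ^ 2))) =
      (1 - b) * (ν₁ * n₁ / 2 + (∫ y in (-π)..π, ∫ x in (-π)..π,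
          max (Real.cos x + Real.cos y + 4 * t₁ * (Real.cos x * Real.cos y) - ν₁) 0) / (4 * π ^ 2)) +
        b * (ν₂ * n₂ / 2 + (∫ y in (-π)..π, ∫ x in (-π)..π,
          max (Real.cos x + Real.cos y + 4 * t₂ * (Real.cos x * Real.cos y) - ν₂) 0) / (4 * π ^ 2)) +
        b * (1 - b) * ((ν₁ - ν₂) * (n₂ - n₁) / 2) := by
    rw [hbil]
    ring
  linarith [hmono, hdiv, hA, hB, hcb, e]

/-- **The decidable SIDE CONDITION from the two readings**: if `r₁ ≤ c`, `r₂ ≤ c` and the bilinear slack is absorbed by the reading gap,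
`max((ν₁−ν₂)(n₂−n₁)/2, 0) ≤ |r₁ − r₂|`, then `(1−b)r₁ + b r₂ + b(1−b)(ν₁−ν₂)(n₂−n₁)/2 ≤ c` for every `b ∈ [0, 1]`
(`b(1−b) ≤ min(b, 1−b)`; the weighted average plus `min(b, 1−b)·|r₁ − r₂|` never exceeds `max(r₁, r₂)`). [folklore] -/
theorem slant_sideCondition_of_readings {ν₁ ν₂ n₁ n₂ r₁ r₂ c : ℝ} (hr₁ : r₁ ≤ c) (hr₂ : r₂ ≤ c)
    (hD : max ((ν₁ - ν₂) * (n₂ - n₁) / 2) 0 ≤ |r₁ - r₂|) :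
    ∀ b : ℝ, 0 ≤ b → b ≤ 1 → (1 - b) * r₁ + b * r₂ + b * (1 - b) * ((ν₁ - ν₂) * (n₂ - n₁) / 2) ≤ c := by
  intro b hb0 hb1
  have hM : 0 ≤ max ((ν₁ - ν₂) * (n₂ - n₁) / 2) 0 := le_max_right _ _
  have hbb : 0 ≤ b * (1 - b) := mul_nonneg hb0 (sub_nonneg.2 hb1)
  have h1 : b * (1 - b) * ((ν₁ - ν₂) * (n₂ - n₁) / 2) ≤ b * (1 - b) * max ((ν₁ - ν₂) * (n₂ - n₁) / 2) 0 :=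
    mul_le_mul_of_nonneg_left (le_max_left _ _) hbb
  have hb_le : b * (1 - b) ≤ b := by nlinarith
  have ha_le : b * (1 - b) ≤ 1 - b := by nlinarith
  rcases le_total r₂ r₁ with h | h
  · rw [abs_of_nonneg (sub_nonneg.2 h)] at hD
    have h2 : b * (1 - b) * max ((ν₁ - ν₂) * (n₂ - n₁) / 2) 0 ≤ b * (r₁ - r₂) :=
      (mul_le_mul_of_nonneg_right hb_le hM).trans (mul_le_mul_of_nonneg_left hD hb0)
    linarith
  · rw [abs_of_nonpos (sub_nonpos.2 h)] at hD
    have h2 : b * (1 - b) * max ((ν₁ - ν₂) * (n₂ - n₁) / 2) 0 ≤ (1 - b) * (r₂ - r₁) :=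
      (mul_le_mul_of_nonneg_right ha_le hM).trans (mul_le_mul_of_nonneg_left (by linarith) (sub_nonneg.2 hb1))
    linarith

/-- **Slant transport from the reading trio** (`r₁, r₂ ≤ c`, `max((ν₁−ν₂)(n₂−n₁)/2, 0) ≤ |r₁ − r₂|`): every point of the trapezoid
under the chord admits a level `ν ≥ 0` with `ν·n/2 + B(t′, ν) ≤ c`. [cite: HazraVermaRanderia2019, eqs. (2)–(6)] -/
theorem halfBathtub_slant_le_of_readings {t₁ t₂ ν₁ ν₂ n₁ n₂ r₁ r₂ c : ℝ} (ht : t₁ < t₂) (hν₁ : 0 ≤ ν₁) (hν₂ : 0 ≤ ν₂)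
    (h₁ : ν₁ * n₁ / 2 +
      (∫ y in (-π)..π, ∫ x in (-π)..π, max (Real.cos x + Real.cos y + 4 * t₁ * (Real.cos x * Real.cos y) - ν₁) 0) /
        (4 * π ^ 2) ≤ r₁)
    (h₂ : ν₂ * n₂ / 2 +
      (∫ y in (-π)..π, ∫ x in (-π)..π, max (Real.cos x + Real.cos y + 4 * t₂ * (Real.cos x * Real.cos y) - ν₂) 0) /
        (4 * π ^ 2) ≤ r₂)
    (hr₁ : r₁ ≤ c) (hr₂ : r₂ ≤ c) (hD : max ((ν₁ - ν₂) * (n₂ - n₁) / 2) 0 ≤ |r₁ - r₂|)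
    {tp n : ℝ} (htp : tp ∈ Icc t₁ t₂) (hn : n ≤ n₁ + (n₂ - n₁) * ((tp - t₁) / (t₂ - t₁))) :
    ∃ ν : ℝ, 0 ≤ ν ∧ ν * n / 2 +
      (∫ y in (-π)..π, ∫ x in (-π)..π, max (Real.cos x + Real.cos y + 4 * tp * (Real.cos x * Real.cos y) - ν) 0) /
        (4 * π ^ 2) ≤ c :=
  halfBathtub_slant_le ht hν₁ hν₂ h₁ h₂ (slant_sideCondition_of_readings hr₁ hr₂ hD) htp hn

/-! ## §2 Corner readings ⇒ the leaves on the trapezoid under the chord (every `U`) -/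

/-- **Two corner readings ⇒ the GROUND-STATE stiffness leaf on the trapezoid under the chord**: corners `(t′₁, n₁)`, `(t′₂, n₂)`
(`t′₁ < t′₂`, `n₁, n₂ ≤ 2`), levels `νᵢ ≥ 0`, readings `νᵢ·nᵢ/2 + B(t′ᵢ, νᵢ) ≤ rᵢ ≤ c` (`c` rational) and
`max((ν₁−ν₂)(n₂−n₁)/2, 0) ≤ |r₁ − r₂|` give `ObsStiffnessSeqCeilingAt tp U n c` for every `t′ ∈ [t′₁, t′₂]`, every
`0 ≤ n ≤ n₁ + (n₂−n₁)(t′−t′₁)/(t′₂−t′₁)` and every `U` (`ObsStiffnessSeqCeilingAt_of_halfBathtub_le` at the chord level).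
[cite: HazraVermaRanderia2019, eqs. (2)–(6)] -/
theorem ObsStiffnessSeqCeilingAt_slant_of_corners_le {t₁ t₂ ν₁ ν₂ n₁ n₂ r₁ r₂ : ℝ} (ht : t₁ < t₂)
    (hν₁ : 0 ≤ ν₁) (hν₂ : 0 ≤ ν₂) (hn₁ : n₁ ≤ 2) (hn₂ : n₂ ≤ 2) (c : ℚ)
    (h₁ : ν₁ * n₁ / 2 +
      (∫ y in (-π)..π, ∫ x in (-π)..π, max (Real.cos x + Real.cos y + 4 * t₁ * (Real.cos x * Real.cos y) - ν₁) 0) /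
        (4 * π ^ 2) ≤ r₁)
    (h₂ : ν₂ * n₂ / 2 +
      (∫ y in (-π)..π, ∫ x in (-π)..π, max (Real.cos x + Real.cos y + 4 * t₂ * (Real.cos x * Real.cos y) - ν₂) 0) /
        (4 * π ^ 2) ≤ r₂)
    (hr₁ : r₁ ≤ ((c : ℚ) : ℝ)) (hr₂ : r₂ ≤ ((c : ℚ) : ℝ)) (hD : max ((ν₁ - ν₂) * (n₂ - n₁) / 2) 0 ≤ |r₁ - r₂|)
    {tp U n : ℝ} (htp : tp ∈ Icc t₁ t₂) (hn0 : 0 ≤ n) (hn : n ≤ n₁ + (n₂ - n₁) * ((tp - t₁) / (t₂ - t₁))) :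
    ObsStiffnessSeqCeilingAt tp U n c := by
  obtain ⟨ν, -, hν⟩ := halfBathtub_slant_le_of_readings ht hν₁ hν₂ h₁ h₂ hr₁ hr₂ hD htp hn
  obtain ⟨hb0, hb1, -⟩ := slant_param_mem ht htp
  exact ObsStiffnessSeqCeilingAt_of_halfBathtub_le tp U n hn0 (le_two_of_le_chord hn₁ hn₂ hb0 hb1 hn) ν c hν

/-- **Two corner readings ⇒ the THERMAL stiffness leaf on the trapezoid under the chord** (every `β > 0`, every `U`; key K1t, no
monotonicity): same hypotheses, conclusion `ObsThermalStiffnessSeqCeilingAt tp U n c`. [cite: ParamekantiTrivediRanderia1998, eq. (3) and §IV] -/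
theorem ObsThermalStiffnessSeqCeilingAt_slant_of_corners_le {t₁ t₂ ν₁ ν₂ n₁ n₂ r₁ r₂ : ℝ} (ht : t₁ < t₂)
    (hν₁ : 0 ≤ ν₁) (hν₂ : 0 ≤ ν₂) (hn₁ : n₁ ≤ 2) (hn₂ : n₂ ≤ 2) (c : ℚ)
    (h₁ : ν₁ * n₁ / 2 +
      (∫ y in (-π)..π, ∫ x in (-π)..π, max (Real.cos x + Real.cos y + 4 * t₁ * (Real.cos x * Real.cos y) - ν₁) 0) /
        (4 * π ^ 2) ≤ r₁)
    (h₂ : ν₂ * n₂ / 2 +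
      (∫ y in (-π)..π, ∫ x in (-π)..π, max (Real.cos x + Real.cos y + 4 * t₂ * (Real.cos x * Real.cos y) - ν₂) 0) /
        (4 * π ^ 2) ≤ r₂)
    (hr₁ : r₁ ≤ ((c : ℚ) : ℝ)) (hr₂ : r₂ ≤ ((c : ℚ) : ℝ)) (hD : max ((ν₁ - ν₂) * (n₂ - n₁) / 2) 0 ≤ |r₁ - r₂|)
    {tp U n : ℝ} (htp : tp ∈ Icc t₁ t₂) (hn0 : 0 ≤ n) (hn : n ≤ n₁ + (n₂ - n₁) * ((tp - t₁) / (t₂ - t₁))) :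
    ObsThermalStiffnessSeqCeilingAt tp U n c := by
  obtain ⟨ν, -, hν⟩ := halfBathtub_slant_le_of_readings ht hν₁ hν₂ h₁ h₂ hr₁ hr₂ hD htp hn
  obtain ⟨hb0, hb1, -⟩ := slant_param_mem ht htp
  exact ObsThermalStiffnessSeqCeilingAt_of_halfBathtub_le tp U n hn0 (le_two_of_le_chord hn₁ hn₂ hb0 hb1 hn) ν c hν

/-- The general form with the `∀ b` side condition (for corner pairs whose slack is not absorbed by the reading gap): ground-state leaf
`c` on the trapezoid under the chord, every `U`. [cite: HazraVermaRanderia2019, eqs. (2)–(6)] -/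
theorem ObsStiffnessSeqCeilingAt_slant_of_sideCondition {t₁ t₂ ν₁ ν₂ n₁ n₂ r₁ r₂ : ℝ} (ht : t₁ < t₂)
    (hν₁ : 0 ≤ ν₁) (hν₂ : 0 ≤ ν₂) (hn₁ : n₁ ≤ 2) (hn₂ : n₂ ≤ 2) (c : ℚ)
    (h₁ : ν₁ * n₁ / 2 +
      (∫ y in (-π)..π, ∫ x in (-π)..π, max (Real.cos x + Real.cos y + 4 * t₁ * (Real.cos x * Real.cos y) - ν₁) 0) /
        (4 * π ^ 2) ≤ r₁)
    (h₂ : ν₂ * n₂ / 2 +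
      (∫ y in (-π)..π, ∫ x in (-π)..π, max (Real.cos x + Real.cos y + 4 * t₂ * (Real.cos x * Real.cos y) - ν₂) 0) /
        (4 * π ^ 2) ≤ r₂)
    (hc : ∀ b : ℝ, 0 ≤ b → b ≤ 1 →
      (1 - b) * r₁ + b * r₂ + b * (1 - b) * ((ν₁ - ν₂) * (n₂ - n₁) / 2) ≤ ((c : ℚ) : ℝ))
    {tp U n : ℝ} (htp : tp ∈ Icc t₁ t₂) (hn0 : 0 ≤ n) (hn : n ≤ n₁ + (n₂ - n₁) * ((tp - t₁) / (t₂ - t₁))) :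
    ObsStiffnessSeqCeilingAt tp U n c := by
  obtain ⟨ν, -, hν⟩ := halfBathtub_slant_le ht hν₁ hν₂ h₁ h₂ hc htp hn
  obtain ⟨hb0, hb1, -⟩ := slant_param_mem ht htp
  exact ObsStiffnessSeqCeilingAt_of_halfBathtub_le tp U n hn0 (le_two_of_le_chord hn₁ hn₂ hb0 hb1 hn) ν c hν

/-! ## §3 The KT readings over the trapezoid -/

/-- **KT reading under the chord (thermal dictionary)**: the corner readings and the monotonicity-free KT dictionary
`ThermalKTDictionaryAt tp U n ρₑ Tc` at ANY anchor of the trapezoid give `Tc ≤ (π/4)·c` (tree units, `t = 1`).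
[cite: HazraVermaRanderia2019, eqs. (2)–(3) and App. G] -/
theorem ThermalKTDictionaryAt.le_pi_div_four_mul_slant {t₁ t₂ ν₁ ν₂ n₁ n₂ r₁ r₂ : ℝ} (ht : t₁ < t₂)
    (hν₁ : 0 ≤ ν₁) (hν₂ : 0 ≤ ν₂) (hn₁ : n₁ ≤ 2) (hn₂ : n₂ ≤ 2) (c : ℚ)
    (h₁ : ν₁ * n₁ / 2 +
      (∫ y in (-π)..π, ∫ x in (-π)..π, max (Real.cos x + Real.cos y + 4 * t₁ * (Real.cos x * Real.cos y) - ν₁) 0) /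
        (4 * π ^ 2) ≤ r₁)
    (h₂ : ν₂ * n₂ / 2 +
      (∫ y in (-π)..π, ∫ x in (-π)..π, max (Real.cos x + Real.cos y + 4 * t₂ * (Real.cos x * Real.cos y) - ν₂) 0) /
        (4 * π ^ 2) ≤ r₂)
    (hr₁ : r₁ ≤ ((c : ℚ) : ℝ)) (hr₂ : r₂ ≤ ((c : ℚ) : ℝ)) (hD : max ((ν₁ - ν₂) * (n₂ - n₁) / 2) 0 ≤ |r₁ - r₂|)
    {tp U n : ℝ} (htp : tp ∈ Icc t₁ t₂) (hn0 : 0 ≤ n) (hn : n ≤ n₁ + (n₂ - n₁) * ((tp - t₁) / (t₂ - t₁)))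
    {ρe : ℝ → ℝ} {Tc : ℝ} (h : ThermalKTDictionaryAt tp U n ρe Tc) : Tc ≤ π / 4 * ((c : ℚ) : ℝ) :=
  h.le_pi_div_four_mul (ObsThermalStiffnessSeqCeilingAt_slant_of_corners_le ht hν₁ hν₂ hn₁ hn₂ c h₁ h₂ hr₁ hr₂ hD htp hn0 hn)

/-- The ground-state KT reading under the chord (p2's dictionary `KTDictionaryAt`). [cite: HazraVermaRanderia2019, eqs. (2)–(3)] -/
theorem KTDictionaryAt.le_pi_div_four_mul_slant {t₁ t₂ ν₁ ν₂ n₁ n₂ r₁ r₂ : ℝ} (ht : t₁ < t₂)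
    (hν₁ : 0 ≤ ν₁) (hν₂ : 0 ≤ ν₂) (hn₁ : n₁ ≤ 2) (hn₂ : n₂ ≤ 2) (c : ℚ)
    (h₁ : ν₁ * n₁ / 2 +
      (∫ y in (-π)..π, ∫ x in (-π)..π, max (Real.cos x + Real.cos y + 4 * t₁ * (Real.cos x * Real.cos y) - ν₁) 0) /
        (4 * π ^ 2) ≤ r₁)
    (h₂ : ν₂ * n₂ / 2 +
      (∫ y in (-π)..π, ∫ x in (-π)..π, max (Real.cos x + Real.cos y + 4 * t₂ * (Real.cos x * Real.cos y) - ν₂) 0) /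
        (4 * π ^ 2) ≤ r₂)
    (hr₁ : r₁ ≤ ((c : ℚ) : ℝ)) (hr₂ : r₂ ≤ ((c : ℚ) : ℝ)) (hD : max ((ν₁ - ν₂) * (n₂ - n₁) / 2) 0 ≤ |r₁ - r₂|)
    {tp U n : ℝ} (htp : tp ∈ Icc t₁ t₂) (hn0 : 0 ≤ n) (hn : n ≤ n₁ + (n₂ - n₁) * ((tp - t₁) / (t₂ - t₁)))
    {ρe : ℝ → ℝ} {Tc : ℝ} (h : KTDictionaryAt tp U n ρe Tc) : Tc ≤ π / 4 * ((c : ℚ) : ℝ) :=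
  h.le_pi_div_four_mul (ObsStiffnessSeqCeilingAt_slant_of_corners_le ht hν₁ hν₂ hn₁ hn₂ c h₁ h₂ hr₁ hr₂ hD htp hn0 hn)

end Summit.Ventures.CertifiedManyBodySolver.Observables

end
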